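import Literature.NumberTheory.Automorphic.FinWhittakerThinTwoValued
import Literature.NumberTheory.Automorphic.TorusPairIntegrandThinSupport
import Literature.NumberTheory.Automorphic.SpreadProjectorWhittaker
import Literature.NumberTheory.Automorphic.BorelStabilizerLattice
import Literature.NumberTheory.Automorphic.ArchWhittakerTranslate
import HarnessLib

/-!
# The finite factor of the thin pair integrand on the unit box is two-valued

Topic `NumberTheory/Automorphic`; namespace `Literature.NumberTheory.Automorphic`. Theorems only (no
definition, no named fact). The bad-place computation for Corollaire (i)(b) of Mœglin–Waldspurger
(1989) (Jacquet–Piatetski-Shapiro–Shalika (1983), (2.7), p. 393: at a non-archimedean place the local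
Rankin–Selberg integral of suitable data "is a non-zero constant"), in the shape consumed by the
splitting `exists_const_setIntegral_unitBox_two_valued_mul_eq` (`UnitBoxFiniteArchSplitting`). Let
`w`, `w'` be functions on `GL_{n+1}(𝔸_K^∞)` (the finite Whittaker functions of a spread intertwiner of
`π` and of an intertwiner of `σ̄`) such that, at every place `v` of a finite set `S`,

* `w`, `w'` are left `ψ_v`-equivariant under `N(K_v)`;
* `g ↦ w(g_f)` is spread bi-equivariant at `v` for torus parameters with the inequalities of the
  support theorem (`IsSpreadWhittakerAt`, e.g. from `isSpreadWhittakerAt_of_key`);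
* `w'` is right invariant under `K(𝔭_v^{M_v})`;

and `w`, `w'` are right invariant under principal congruence subgroups `K_f(𝔫_w)`, `K_f(𝔫_{w'})` whose
prime divisors lie in `S`. Then for `D_f ∈ GL_{n+1}(𝔸_K^∞)` trivial at the places of `S`, the finite
factor `F(a, k) = w(D_f g_f) \overline{w'(D_f g_f)} 𝟙_{thin}(g_f)`, `g = diag(a) k`, takes on the unit
box `𝕌_K^{n+1} × K` only the values `0` and `F(1) = w(D_f) \overline{w'(D_f)}`
(`finFactor_eq_zero_or_eq_apply_one`): where the thin indicator and `w` do not vanish, the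
`S`-components of `(1, D_f) diag(a) k` are stripped one at a time
(`exists_stripped_apply_mul_conj_apply_eq`), and the stripped finite part is `D_f z` with `z` in both
principal congruence subgroups (trivial at `S`, integral off `S`).

## References

* H. Jacquet, I. I. Piatetski-Shapiro, J. A. Shalika, *Rankin–Selberg convolutions*, Amer. J. Math.
  105 (1983), §2, (2.7), p. 393 [JacquetPiatetskiShapiroShalika1983].
* C. Mœglin, J.-L. Waldspurger, *Le spectre résiduel de GL(n)*, Ann. Sci. ÉNS 22 (1989), Appendice,
  p. 667 [MoeglinWaldspurger1989].
-/

noncomputable section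

open MeasureTheory NumberField IsDedekindDomain Matrix Set WithZero
open scoped MatrixGroups ComplexConjugate
open Literature.NumberTheory.Automorphic.WhittakerSupport
open Literature.NumberTheory.GaloisRepresentations (ideleGroup)

namespace Literature.NumberTheory.Automorphic

/-! ### Spread bi-equivariance from the `(H_v, χ_v)`-equivariance -/

section Key

open ValuativeRel

variable {N : ℕ} {K : Type} [Field K] [NumberField K] {v : HeightOneSpectrum (𝓞 K)}

/-- **`W(g ι_v(h)) = χ_v(h) W(g)` on `H_v` makes `W` spread bi-equivariant at `v`** (the unipotents of
the band lie in `H_v` with `χ_v = ψ_{v,N}`, the `d`-twisted congruence elements lie in `H_v` with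
`χ_v = 1`; the argument of `isSpreadWhittakerAt_of_isotypic`, for an abstract `W`). [folklore] -/
theorem isSpreadWhittakerAt_of_key {t : Fin N → (v.adicCompletion K)ˣ} {M : ℤ} (hM : 0 ≤ M)
    (hψ : ∀ i j : Fin N, (i : ℕ) + 1 = j → ∀ x : v.adicCompletion K, Valued.v x ≤ exp (-M) →
      (adeleAddChar K).adicComponent v ((t i : v.adicCompletion K) * (t j : v.adicCompletion K)⁻¹ * x) = 1)
    {W : GL (Fin N) (AdeleRing (𝓞 K) K) → ℂ}
    (key : ∀ h ∈ spreadLevelGroup t M, ∀ g : GL (Fin N) (AdeleRing (𝓞 K) K),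
      W (g * GLn.ofLocal N K v h) = spreadChar v h * W g) :
    IsSpreadWhittakerAt v (adeleAddChar K) t M W := by
  refine ⟨fun u' hu' hbd g => ?_, fun κ hκ hκ' g => ?_⟩
  · rw [key u' (mem_spreadLevelGroup_of_mem_upperUnitriangular hu' hbd) g, ← spreadChar_unipotent v ⟨u', hu'⟩]
  · rw [key κ (mem_spreadLevelGroup_of_level hM hκ hκ') g, spreadChar_apply,
      addChar_sdiagMat_eq_one_of_level ((adeleAddChar K).adicComponent v) hψ hκ, Circle.coe_one, one_mul]

end Key

/-! ### The finite factor on the unit box -/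

section FinFactor

open ValuativeRel

variable {n : ℕ} {K : Type} [Field K] [NumberField K]

/-- **The finite factor at `1`** is `w(D_f) \overline{w'(D_f)}` (`e_{n+1}` lies in the thin box). [folklore] -/
theorem finFactor_one {w w' : GL (Fin (n + 1)) (FiniteAdeleRing (𝓞 K) K) → ℂ}
    (T : Finset (HeightOneSpectrum (𝓞 K))) (m : ℕ) (Df : GL (Fin (n + 1)) (FiniteAdeleRing (𝓞 K) K)) :
    w (Df * GLn.sndHom (n + 1) K (torusPoint (n + 1) K 1)) * conj (w' (Df * GLn.sndHom (n + 1) K (torusPoint (n + 1) K 1))) *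
        thinIndicatorGL (n + 1) K T m (GLn.sndHom (n + 1) K (torusPoint (n + 1) K 1)) =
      w Df * conj (w' Df) := by
  have h1 : torusPoint (n + 1) K (1 : (Fin (n + 1) → ideleGroup K) × ↥(maximalCompactAdelic (n + 1) K)) = 1 := by
    simp only [torusPoint, Prod.fst_one, Prod.snd_one, map_one, one_mul]
    rfl
  rw [h1, map_one, mul_one, thinIndicatorGL_one, mul_one]

/-- The `v`-component of `(1, D_f) g` is the `v`-component of `g` when `D_f` is trivial at `v`. [folklore] -/
theorem localComponent_ofFinite_mul_of_eq_one {v : HeightOneSpectrum (𝓞 K)}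
    {Df : GL (Fin (n + 1)) (FiniteAdeleRing (𝓞 K) K)} (hDf : BigHeckeGLn.localComponent (n + 1) K v Df = 1)
    (g : GL (Fin (n + 1)) (AdeleRing (𝓞 K) K)) :
    localComponent v (GLn.ofFinite (n + 1) K Df * g) = localComponent v g := by
  have h : localComponent v (GLn.ofFinite (n + 1) K Df) = BigHeckeGLn.localComponent (n + 1) K v Df := by
    have h' := BigHeckeGLn.localComponent_sndHom (n := n + 1) (K := K) (v := v) (GLn.ofFinite (n + 1) K Df)
    rw [GLn.sndHom_ofFinite] at h'
    exact h'.symm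
  rw [localComponent, map_mul]
  change localComponent v (GLn.ofFinite (n + 1) K Df) * localComponent v g = localComponent v g
  rw [h, hDf, one_mul]

/-- **The thin indicator gives the last-row congruence of the `v`-component** (`v ∈ T`):
`|(g_v)_{n,j} - δ_{n,j}|_v ≤ q_v^{-m}`. [folklore] -/
theorem lastRow_localComponent_le_of_thinIndicatorGL_ne_zero {T : Finset (HeightOneSpectrum (𝓞 K))} {m : ℕ}
    {g : GL (Fin (n + 1)) (AdeleRing (𝓞 K) K)} (hθ : thinIndicatorGL (n + 1) K T m (GLn.sndHom (n + 1) K g) ≠ 0)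
    {v : HeightOneSpectrum (𝓞 K)} (hv : v ∈ T) (j : Fin (n + 1)) :
    Valued.v (((localComponent v g : GL (Fin (n + 1)) (v.adicCompletion K)) :
        Matrix (Fin (n + 1)) (Fin (n + 1)) (v.adicCompletion K)) (Fin.last n) j -
      if Fin.last n = j then 1 else 0) ≤ exp (-(m : ℤ)) := by
  have hbox : finLastRow (n + 1) K (GLn.sndHom (n + 1) K g) ∈ thinFiniteBox (n + 1) K T m := by
    by_contra h
    apply hθ
    unfold thinIndicatorGL
    rw [if_neg h]
  have h := (mem_thinFiniteBox_iff.1 hbox).2 v hv j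
  rw [finLastRow_sndHom] at h
  change Valued.v ((lastRow (n + 1) K g j).2 v - _) ≤ _ at h
  rw [lastRow_succ_apply] at h
  have hiff : ((j : ℕ) + 1 = n + 1) ↔ Fin.last n = j :=
    ⟨fun h' => (Fin.ext (by rw [Fin.val_last]; omega)).symm, fun h' => by rw [← h', Fin.val_last]⟩
  have hentry : ((localComponent v g : GL (Fin (n + 1)) (v.adicCompletion K)) :
      Matrix (Fin (n + 1)) (Fin (n + 1)) (v.adicCompletion K)) (Fin.last n) j =
      ((g : Matrix (Fin (n + 1)) (Fin (n + 1)) (AdeleRing (𝓞 K) K)) (Fin.last n) j).2 v :=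
    AdelicGroupData.coe_map_adeleEval_apply v g (Fin.last n) j
  rw [hentry]
  by_cases hj : Fin.last n = j
  · rw [if_pos hj]
    rw [if_pos (hiff.2 hj)] at h
    exact h
  · rw [if_neg hj]
    rw [if_neg (fun h' => hj (hiff.1 h'))] at h
    exact h

/-- **The finite factor is two-valued on the unit box** (main). With the hypotheses of the module
docstring at every `v ∈ S`, for `D_f` trivial at the places of `S` and `p = (a, k)` with `a ∈ 𝕌_K^{n+1}`:
`F(p) = 0` or `F(p) = w(D_f) \overline{w'(D_f)}`.
[cite: JacquetPiatetskiShapiroShalika1983, §2 (2.7), p. 393] -/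
theorem finFactor_eq_zero_or_eq_apply_one
    {w w' : GL (Fin (n + 1)) (FiniteAdeleRing (𝓞 K) K) → ℂ} (S : Finset (HeightOneSpectrum (𝓞 K)))
    {t : ∀ v : HeightOneSpectrum (𝓞 K), Fin (n + 1) → (v.adicCompletion K)ˣ} {M c₀ : HeightOneSpectrum (𝓞 K) → ℤ}
    (hwN : ∀ v ∈ S, ∀ (u : GL (Fin (n + 1)) (v.adicCompletion K)) (hu : u ∈ upperUnitriangular (Fin (n + 1)) (v.adicCompletion K))
      (y : GL (Fin (n + 1)) (FiniteAdeleRing (𝓞 K) K)),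
      w (GLn.sndHom (n + 1) K (GLn.ofLocal (n + 1) K v u) * y) = whittakerCharFun ((adeleAddChar K).adicComponent v) ⟨u, hu⟩ * w y)
    (hw'N : ∀ v ∈ S, ∀ (u : GL (Fin (n + 1)) (v.adicCompletion K)) (hu : u ∈ upperUnitriangular (Fin (n + 1)) (v.adicCompletion K))
      (y : GL (Fin (n + 1)) (FiniteAdeleRing (𝓞 K) K)),
      w' (GLn.sndHom (n + 1) K (GLn.ofLocal (n + 1) K v u) * y) = whittakerCharFun ((adeleAddChar K).adicComponent v) ⟨u, hu⟩ * w' y)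
    (hwS : ∀ v ∈ S, IsSpreadWhittakerAt v (adeleAddChar K) (t v) (M v) (fun g => w (GLn.sndHom (n + 1) K g)))
    (hψv : ∀ v ∈ S, ∃ x : v.adicCompletion K, Valued.v x ≤ exp (1 - c₀ v) ∧ (adeleAddChar K).adicComponent v x ≠ 1)
    (hM₁ : ∀ v ∈ S, 1 ≤ M v)
    (hmono : ∀ v ∈ S, ∀ i j : Fin (n + 1), i ≤ j → Valued.v (t v j : v.adicCompletion K) ≤ Valued.v (t v i : v.adicCompletion K))
    (hgap : ∀ v ∈ S, ∀ i j : Fin (n + 1), (i : ℕ) + 1 = j →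
      exp (M v - c₀ v) * Valued.v (t v j : v.adicCompletion K) ≤ Valued.v (t v i : v.adicCompletion K))
    {m : ℕ}
    (hmt : ∀ v ∈ S, exp (-(m : ℤ)) * Valued.v (t v 0 : v.adicCompletion K) ≤ exp (-M v) * Valued.v (t v (Fin.last n) : v.adicCompletion K))
    (hw'K : ∀ v ∈ S, ∀ k ∈ valuedCongruenceSubgroup (Fin (n + 1)) (exp (-M v)), ∀ y : GL (Fin (n + 1)) (FiniteAdeleRing (𝓞 K) K),
      w' (y * GLn.sndHom (n + 1) K (GLn.ofLocal (n + 1) K v k)) = w' y)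
    {𝔫w : Ideal (𝓞 K)} (h𝔫w : 𝔫w ≠ 0) (hS𝔫w : ∀ v : HeightOneSpectrum (𝓞 K), v.asIdeal ∣ 𝔫w → v ∈ S)
    (hwU : ∀ u ∈ finitePrincipalCongruenceLevel (n + 1) K 𝔫w, ∀ y, w (y * u) = w y)
    {𝔫w' : Ideal (𝓞 K)} (h𝔫w' : 𝔫w' ≠ 0) (hS𝔫w' : ∀ v : HeightOneSpectrum (𝓞 K), v.asIdeal ∣ 𝔫w' → v ∈ S)
    (hw'U : ∀ u ∈ finitePrincipalCongruenceLevel (n + 1) K 𝔫w', ∀ y, w' (y * u) = w' y)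
    {Df : GL (Fin (n + 1)) (FiniteAdeleRing (𝓞 K) K)} (hDfS : ∀ v ∈ S, BigHeckeGLn.localComponent (n + 1) K v Df = 1)
    (p : (Fin (n + 1) → ideleGroup K) × ↥(maximalCompactAdelic (n + 1) K))
    (hp : p.1 ∈ unitBox (n := n + 1) (K := K) (Set.univ : Set (HeightOneSpectrum (𝓞 K)))) :
    w (Df * GLn.sndHom (n + 1) K (torusPoint (n + 1) K p)) * conj (w' (Df * GLn.sndHom (n + 1) K (torusPoint (n + 1) K p))) *
        thinIndicatorGL (n + 1) K S m (GLn.sndHom (n + 1) K (torusPoint (n + 1) K p)) = 0 ∨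
    w (Df * GLn.sndHom (n + 1) K (torusPoint (n + 1) K p)) * conj (w' (Df * GLn.sndHom (n + 1) K (torusPoint (n + 1) K p))) *
        thinIndicatorGL (n + 1) K S m (GLn.sndHom (n + 1) K (torusPoint (n + 1) K p)) = w Df * conj (w' Df) := by
  classical
  set tp : GL (Fin (n + 1)) (AdeleRing (𝓞 K) K) := torusPoint (n + 1) K p with htp
  by_cases hθ : thinIndicatorGL (n + 1) K S m (GLn.sndHom (n + 1) K tp) = 0
  · left; rw [hθ, mul_zero]
  have hθ1 : thinIndicatorGL (n + 1) K S m (GLn.sndHom (n + 1) K tp) = 1 :=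
    (thinIndicatorGL_eq_zero_or_one S m _).resolve_left hθ
  by_cases hw0 : w (Df * GLn.sndHom (n + 1) K tp) = 0
  · left; rw [hw0, zero_mul, zero_mul]
  right
  rw [hθ1, mul_one]
  -- the global point `g = (1, D_f) · diag(a) k` and the global functions `W̃(g) = w(g_f)`, `W̃'(g) = w'(g_f)`
  set g : GL (Fin (n + 1)) (AdeleRing (𝓞 K) K) := GLn.ofFinite (n + 1) K Df * tp with hg
  have hgf : GLn.sndHom (n + 1) K g = Df * GLn.sndHom (n + 1) K tp := by rw [hg, map_mul, GLn.sndHom_ofFinite]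
  have hgv : ∀ v ∈ S, localComponent v g = localComponent v tp := fun v hv =>
    localComponent_ofFinite_mul_of_eq_one (hDfS v hv) tp
  set Wt : GL (Fin (n + 1)) (AdeleRing (𝓞 K) K) → ℂ := fun x => w (GLn.sndHom (n + 1) K x) with hWt
  set Wt' : GL (Fin (n + 1)) (AdeleRing (𝓞 K) K) → ℂ := fun x => w' (GLn.sndHom (n + 1) K x) with hWt'
  have hWN : ∀ v ∈ S, ∀ (u : GL (Fin (n + 1)) (v.adicCompletion K)) (hu : u ∈ upperUnitriangular (Fin (n + 1)) (v.adicCompletion K))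
      (x : GL (Fin (n + 1)) (AdeleRing (𝓞 K) K)),
      Wt (GLn.ofLocal (n + 1) K v u * x) = whittakerCharFun ((adeleAddChar K).adicComponent v) ⟨u, hu⟩ * Wt x := by
    intro v hv u hu x
    simp only [hWt]
    rw [map_mul]
    exact hwN v hv u hu _
  have hW'N : ∀ v ∈ S, ∀ (u : GL (Fin (n + 1)) (v.adicCompletion K)) (hu : u ∈ upperUnitriangular (Fin (n + 1)) (v.adicCompletion K))
      (x : GL (Fin (n + 1)) (AdeleRing (𝓞 K) K)),
      Wt' (GLn.ofLocal (n + 1) K v u * x) = whittakerCharFun ((adeleAddChar K).adicComponent v) ⟨u, hu⟩ * Wt' x := by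
    intro v hv u hu x
    simp only [hWt']
    rw [map_mul]
    exact hw'N v hv u hu _
  have hW'K : ∀ v ∈ S, ∀ k ∈ valuedCongruenceSubgroup (Fin (n + 1)) (exp (-M v)), ∀ x : GL (Fin (n + 1)) (AdeleRing (𝓞 K) K),
      Wt' (x * GLn.ofLocal (n + 1) K v k) = Wt' x := by
    intro v hv k hk x
    simp only [hWt']
    rw [map_mul]
    exact hw'K v hv k hk _
  have hlast : ∀ v ∈ S, ∀ j : Fin (n + 1),
      Valued.v (((localComponent v g : GL (Fin (n + 1)) (v.adicCompletion K)) :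
          Matrix (Fin (n + 1)) (Fin (n + 1)) (v.adicCompletion K)) (Fin.last n) j -
        if Fin.last n = j then 1 else 0) ≤ exp (-((fun _ : HeightOneSpectrum (𝓞 K) => (m : ℤ)) v)) := by
    intro v hv j
    rw [hgv v hv]
    exact lastRow_localComponent_le_of_thinIndicatorGL_ne_zero hθ hv j
  have hne : Wt g ≠ 0 := by simp only [hWt]; rwa [hgf]
  -- strip the `S`-components
  obtain ⟨g', hg'S, hg'off, ⟨y, -, hg'f⟩, hprod, -⟩ :=
    exists_stripped_apply_mul_conj_apply_eq S hWN hW'N hwS hψv hM₁ hmono hgap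
      (m₀ := fun _ => (m : ℤ)) hmt hW'K hlast hne
  -- the stripped finite part is `D_f z` with `z` in both principal congruence subgroups
  set z : GL (Fin (n + 1)) (FiniteAdeleRing (𝓞 K) K) := Df⁻¹ * GLn.sndHom (n + 1) K g' with hz
  have hzeq : GLn.sndHom (n + 1) K g' = Df * z := by rw [hz, mul_inv_cancel_left]
  have hint : GLn.sndHom (n + 1) K tp ∈ glFiniteIntegralLevel (n + 1) K := by
    rw [htp]
    obtain ⟨a, kk⟩ := p
    exact sndHom_torusPoint_mem_glFiniteIntegralLevel hp kk
  have hzloc : ∀ v : HeightOneSpectrum (𝓞 K), BigHeckeGLn.localComponent (n + 1) K v z =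
      if v ∈ S then 1 else BigHeckeGLn.localComponent (n + 1) K v (GLn.sndHom (n + 1) K tp) := by
    intro v
    rw [hz, map_mul, map_inv, BigHeckeGLn.localComponent_sndHom]
    change (BigHeckeGLn.localComponent (n + 1) K v Df)⁻¹ * localComponent v g' = _
    by_cases hv : v ∈ S
    · rw [if_pos hv, hDfS v hv, inv_one, one_mul, hg'S v hv]
    · rw [if_neg hv, hg'off v hv, hg, BigHeckeGLn.localComponent_sndHom]
      change (BigHeckeGLn.localComponent (n + 1) K v Df)⁻¹ * localComponent v (GLn.ofFinite (n + 1) K Df * tp) =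
        localComponent v tp
      rw [show localComponent v (GLn.ofFinite (n + 1) K Df * tp) = localComponent v (GLn.ofFinite (n + 1) K Df) * localComponent v tp
          from map_mul _ _ _]
      have h' : localComponent v (GLn.ofFinite (n + 1) K Df) = BigHeckeGLn.localComponent (n + 1) K v Df := by
        have h'' := BigHeckeGLn.localComponent_sndHom (n := n + 1) (K := K) (v := v) (GLn.ofFinite (n + 1) K Df)
        rw [GLn.sndHom_ofFinite] at h''
        exact h''.symm
      rw [h', inv_mul_cancel_left]
  have hzmem : ∀ {𝔫 : Ideal (𝓞 K)}, 𝔫 ≠ 0 → (∀ v : HeightOneSpectrum (𝓞 K), v.asIdeal ∣ 𝔫 → v ∈ S) →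
      z ∈ finitePrincipalCongruenceLevel (n + 1) K 𝔫 := by
    intro 𝔫 h𝔫 hS𝔫
    change z ∈ (principalCongruenceLevel (n + 1) K 𝔫).comap (GLn.ofFinite (n + 1) K)
    rw [BigHeckeGLn.mem_comap_principalCongruenceLevel_iff_localComponent]
    intro v
    rw [hzloc v]
    by_cases hv : v ∈ S
    · rw [if_pos hv]; exact one_mem _
    · rw [if_neg hv, idealRadius_eq_one_of_not_dvd h𝔫 (fun h => hv (hS𝔫 v h))]
      exact BigHeckeGLn.localComponent_mem_valuedCongruenceSubgroup_one hint v
  have hw1 : w (GLn.sndHom (n + 1) K g') = w Df := by rw [hzeq, hwU z (hzmem h𝔫w hS𝔫w) Df]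
  have hw1' : w' (GLn.sndHom (n + 1) K g') = w' Df := by rw [hzeq, hw'U z (hzmem h𝔫w' hS𝔫w') Df]
  -- assemble
  have h := hprod
  simp only [hWt, hWt'] at h
  rw [hgf] at h
  rw [h, hw1, hw1']

end FinFactor

end Literature.NumberTheory.Automorphic
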